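import Mathlib
import HarnessLib
import Summits.HubbardSuperconductivity.HubbardSuperconductivity.Theorems.KLProgrammeKLRegimeSplitGenericV4

/-!
# Route `KLProgramme` — generic children of crux K3 `KLRegimeTwoPointLimit` (stmt-HubbardSuperconductivity-19937), VERSION 5:
# the VOLUME-LIMIT child's renormalisation-package binder becomes `R.WF2` — located «VL-R-WF2» (cell gate-hubbard-kl, seat hubbard-kl-k3c4-p1 g16,
# 2026-08-28; PRESTAGE for the pen's (R223)(A1) motion).  Glue `inductionP5` / `k3_inductionP5` / `k3_twoPointLimit_of_childrenP5` PROVED for every bundle;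
# `volumeLimitP3_of_volumeLimitP2`: nothing proved towards a v2 child is lost.

«VL-R-WF2».  Every engine-side door the VL child's data stub consumes (p3's `scaleCovData_/scaleCovSecData_klStepCov_flow_all`,
`transferWtData_klTowerTransfer_flow_all`, the scale-0 doors, and ≈ 15–25 files beneath them) is stated under `R.WF2` (positive tolerances `cr, cz`), as
`EngineP4` itself is; `VolumeLimitP2` alone quantifies `∀ R, R.WF →`, and neither `R.WF ⇒ R.WF2` nor `TowerP_R ⇒ TowerP_{R⁺}` holds (the two-leg slot's
volume-rate clause is contravariant in the history's `R`).  The glue never needed the weaker binder: `inductionP4` obtains `R` from child 2 WITH `R.WF2`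
(`obtain ⟨R, hR2, _⟩ := h₂ …`) and merely weakened it for child 5.  Repair (this module): `VolumeLimitP3` = `VolumeLimitP2` with `R.WF2`; the glue passes `hR2`.
Children of record at a bundle `Pr` and a volume-limit text `VL` become `EngineP4 Pr W | BetaSplitP Pr W | CountertermP2 Pr W | VolumeLimitP3 Pr VL W |
TwoPointAssemblyP3 Pr VL W` once the planner re-points the theses.  Nothing here asserts anything about the Hubbard model.
-/

noncomputable section

namespace Summit.HubbardSuperconductivity.HubbardSuperconductivity.Theorems.KLRegimeSplit

set_option linter.dupNamespace false -- summit = problem name (single-conjunct summit), D-0017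

open Real Finset Filter Literature.MathematicalPhysics.QuantumLattice Literature.Probability.LatticeModels
open Literature.MathematicalPhysics.QuantumLattice.FermiRG
open Summit.HubbardSuperconductivity.HubbardSuperconductivity.Theorems.KLProgrammeLegKernels
open Summit.HubbardSuperconductivity.HubbardSuperconductivity.Theorems.DispersionFlow

/-! ## §1 The two repaired children -/

/-! ## §1 The re-keyed volume-limit child -/

/-- **Child 5, v3: `VolumeLimitP3 Pr VL W`** — `VolumeLimitP2` with the renormalisation package binder `R.WF2` (positive tolerances) in place of `R.WF`: after the four constant records there is
`c₅ > 0`, and the volume-limit predicate of every admissible frame carrying the full tower is owed only for `0 < c ≤ c₅` (Δ16: the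
termwise volume limits are limits of the expansion summed over scales, under the same smallness).  Everything after `c` is
`VolumeLimitP`'s text verbatim. -/
def VolumeLimitP3 (Pr : Preds) (VL : VolLimitSlot) (W : Set ℝ) : Prop :=
  ∀ G : GeoConsts, ∀ P : SplitConsts, ∀ Q : EngConsts, ∀ R : RenConsts, G.WF → P.WF → Q.WF → R.WF2 →
    ∃ c₅ : ℝ, 0 < c₅ ∧ ∀ c : ℝ, 0 < c → c ≤ c₅ → ∃ U₀ : ℝ, 0 < U₀ ∧
      ∀ μ ∈ W, ∀ U : ℝ, 0 < U → U ≤ U₀ → ∀ β : ℝ, klBetaMin ≤ β → β ≤ Real.exp (c / U ^ 2) →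
        ∀ K : TrigPolyC4v, Pr.frameOK R U (nScales β) μ K →
          ∀ (Lstar : ℕ) (Mstar : ℕ → ℕ), TowerP Pr G P Q R β U μ K Lstar Mstar → VL β U μ K Mstar

/-! ## §2 Nothing proved is lost -/

/-- `VolumeLimitP2 → VolumeLimitP3` (`R.WF2` gives `R.WF`). -/
theorem volumeLimitP3_of_volumeLimitP2 {Pr : Preds} {VL : VolLimitSlot} {W : Set ℝ} (h : VolumeLimitP2 Pr VL W) : VolumeLimitP3 Pr VL W :=
  fun G P Q R hG hP hQ hR2 => h G P Q R hG hP hQ hR2.wf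

/-! ## §3 The glue -/

/-- **GLUE, v5** (covariance window `W` receiving `μ - U/2`): `EngineP4`, `BetaSplitP`, `CountertermP2`, `VolumeLimitP2`,
`TwoPointAssemblyP3` on `W` give K3 on the analysis window `KLRegimeTwoPointLimitMu (-1) (-0.15)`.  Order of choices
`G → P → R → Q → (c₀, c₁, c₃, c₅) → c := min (min c₀ c₁) (min c₃ c₅) → U₀` (five `U₀`'s); per `(μ, U, β)`: children 3 + 1 by strong
induction to `n_β` for every admissible frame, child 2's frame, the engine's LAST step at `n_β + 1` on that frame's history, child 5's
volume limits, child 4 — `inductionP3`'s proof verbatim after the four thresholds are met. -/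
theorem inductionP5 {Pr : Preds} {VL : VolLimitSlot} {W : Set ℝ}
    (hW : ∀ μ ∈ Set.Icc (-1 : ℝ) (-0.15), ∀ U : ℝ, 0 < U → U ≤ 1 / 10 → μ - U / 2 ∈ W)
    (h₃ : EngineP4 Pr W) (h₁ : BetaSplitP Pr W) (h₂ : CountertermP2 Pr W) (h₅ : VolumeLimitP3 Pr VL W)
    (h₄ : TwoPointAssemblyP3 Pr VL W) :
    KLRegimeTwoPointLimitMu (-1) (-0.15) := by
  intro a ha
  obtain ⟨G, hG, h₃P⟩ := h₃
  obtain ⟨P, hP, h₁Q⟩ := h₁ G hG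
  obtain ⟨R, hR2, h₂Q⟩ := h₂ G P hG hP
  have hR : R.WF := hR2.wf
  obtain ⟨Q, hQ, c₃, hc₃, h₃c⟩ := h₃P P hP R hR2
  obtain ⟨c₀, hc₀, h₁c⟩ := h₁Q Q hQ
  obtain ⟨c₁, hc₁, h₂c⟩ := h₂Q Q hQ
  obtain ⟨c₅, hc₅, h₅c⟩ := h₅ G P Q R hG hP hQ hR2
  set c : ℝ := min (min c₀ c₁) (min c₃ c₅) with hc_def
  have hc : 0 < c := lt_min (lt_min hc₀ hc₁) (lt_min hc₃ hc₅)
  have hcc₀ : c ≤ c₀ := (min_le_left _ _).trans (min_le_left _ _)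
  have hcc₁ : c ≤ c₁ := (min_le_left _ _).trans (min_le_right _ _)
  have hcc₃ : c ≤ c₃ := (min_le_right _ _).trans (min_le_left _ _)
  have hcc₅ : c ≤ c₅ := (min_le_right _ _).trans (min_le_right _ _)
  obtain ⟨U₃, hU₃, L₃, M₃, h₃main⟩ := h₃c c hc hcc₃
  obtain ⟨U₁, hU₁, L₁, M₁, h₁main⟩ := h₁c c hc hcc₀ R hR
  obtain ⟨U₂, hU₂, h₂main⟩ := h₂c c hc hcc₁
  obtain ⟨U₅, hU₅, h₅main⟩ := h₅c c hc hcc₅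
  obtain ⟨U₄, hU₄, h₄main⟩ := h₄ G P Q R hG hP hQ hR c hc
  have hlog : 0 < Real.log klBetaMin := Real.log_pos (by norm_num [klBetaMin])
  set U₀ : ℝ := min (min (min (min U₁ U₂) (min U₃ (min U₄ U₅))) (a / Real.log klBetaMin)) (1 / 10) with hU₀_def
  have hU₀ : 0 < U₀ :=
    lt_min (lt_min (lt_min (lt_min hU₁ hU₂) (lt_min hU₃ (lt_min hU₄ hU₅))) (div_pos ha hlog)) (by norm_num)
  refine ⟨U₀, c, hU₀, hc, ?_⟩
  intro μ hμ U β hU hUle hβa hβc x y σ σ'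
  have hU5' : U ≤ min (min (min U₁ U₂) (min U₃ (min U₄ U₅))) (a / Real.log klBetaMin) := hUle.trans (min_le_left _ _)
  have hU10 : U ≤ 1 / 10 := hUle.trans (min_le_right _ _)
  have hUm : U ≤ min (min U₁ U₂) (min U₃ (min U₄ U₅)) := hU5'.trans (min_le_left _ _)
  have hU1 : U ≤ U₁ := hUm.trans ((min_le_left _ _).trans (min_le_left _ _))
  have hU2 : U ≤ U₂ := hUm.trans ((min_le_left _ _).trans (min_le_right _ _))
  have hU3 : U ≤ U₃ := hUm.trans ((min_le_right _ _).trans (min_le_left _ _))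
  have hU4 : U ≤ U₄ := hUm.trans ((min_le_right _ _).trans ((min_le_right _ _).trans (min_le_left _ _)))
  have hU5 : U ≤ U₅ := hUm.trans ((min_le_right _ _).trans ((min_le_right _ _).trans (min_le_right _ _)))
  have hβmin : klBetaMin ≤ β := klBetaMin_le_of_exp_le hU hU5' (min_le_right _ _) hβa
  have hKL : ∀ n ≤ nScales β + 1, IsKLRegime U c (-(n : ℤ)) := fun n hn =>
    isKLRegime_of_le_nScales_succ hc.le hβmin hβc hn
  -- the covariance potential
  set ν : ℝ := μ - U / 2 with hν_def
  have hν : ν ∈ W := hW μ hμ U hU hU10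
  -- the glued induction (children 3 + 1) up to `n_β` for EVERY admissible frame, beyond the maxed hypothesis thresholds
  have hall : ∀ K : TrigPolyC4v, Pr.frameOK R U (nScales β) ν K →
      ∀ (L M : ℕ) [NeZero L] [NeZero M], max (L₃ β U) (L₁ β U) ≤ L → max (M₃ β U L) (M₁ β U L) ≤ M →
        ∀ n : ℕ, n ≤ nScales β → (∀ j < n, Pr.renorm L M β U ν K R j) →
          Pr.engine L M G P Q β U ν K n ∧ Pr.twoLeg L M G P Q R β U ν K n ∧
            Pr.split L M G P Q β U ν K n := by
    intro K hK L M _ _ hL hM n hn hRn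
    have hL3 : L₃ β U ≤ L := (le_max_left _ _).trans hL
    have hL1 : L₁ β U ≤ L := (le_max_right _ _).trans hL
    have hM3 : M₃ β U L ≤ M := (le_max_left _ _).trans hM
    have hM1 : M₁ β U L ≤ M := (le_max_right _ _).trans hM
    exact Child.allScales (N := nScales β) (KL := fun n => IsKLRegime U c (-(n : ℤ)))
      (B := fun n => Pr.split L M G P Q β U ν K n) (Rn := fun n => Pr.renorm L M β U ν K R n)
      (E := fun n => Pr.engine L M G P Q β U ν K n) (T := fun n => Pr.twoLeg L M G P Q R β U ν K n)
      (fun n hn hkl hyp => h₃main ν hν U hU hU3 β hβmin hβc K hK L M hL3 hM3 n (Nat.le_succ_of_le hn) hkl hyp)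
      (fun n hn hkl hyp hEn hTn => h₁main ν hν U hU hU1 β hβmin hβc K hK L M hL1 hM1 n hn hkl hyp hEn hTn)
      (fun n hn => hKL n (Nat.le_succ_of_le hn)) n hn hRn
  -- child 2: the volume-uniform renormalised admissible frame and its thresholds
  obtain ⟨K, hK, Lc, Mc, hKR⟩ :=
    h₂main ν hν U hU hU2 β hβmin hβc (max (L₃ β U) (L₁ β U)) (fun L => max (M₃ β U L) (M₁ β U L)) hall
  -- the full tower of K beyond the max of all thresholds, including the engine's LAST step `n_β + 1`
  set Lstar : ℕ := max Lc (max (L₃ β U) (L₁ β U)) with hLstar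
  set Mstar : ℕ → ℕ := fun L => max (Mc L) (max (M₃ β U L) (M₁ β U L)) with hMstar
  have htower : TowerP Pr G P Q R β U ν K Lstar Mstar := by
    intro L M _ _ hL hM
    have hLc : Lc ≤ L := (le_max_left _ _).trans hL
    have hLh : max (L₃ β U) (L₁ β U) ≤ L := (le_max_right _ _).trans hL
    have hL3 : L₃ β U ≤ L := (le_max_left _ _).trans hLh
    have hMc : Mc L ≤ M := (le_max_left _ _).trans hM
    have hMh : max (M₃ β U L) (M₁ β U L) ≤ M := (le_max_right _ _).trans hM
    have hM3 : M₃ β U L ≤ M := (le_max_left _ _).trans hMh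
    have hle : ∀ n : ℕ, n ≤ nScales β →
        Pr.renorm L M β U ν K R n ∧ Pr.split L M G P Q β U ν K n ∧
          Pr.engine L M G P Q β U ν K n ∧ Pr.twoLeg L M G P Q R β U ν K n := by
      intro n hn
      have h := hall K hK L M hLh hMh n hn fun j hj => hKR L M hLc hMc j (le_of_lt (lt_of_lt_of_le hj hn))
      exact ⟨hKR L M hLc hMc n hn, h.2.2, h.1, h.2.1⟩
    refine ⟨hle, ?_⟩
    -- the last step: history = the tower at `j ≤ n_β`
    have hhist : HistP Pr L M G P Q R β U ν K (nScales β + 1) := by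
      intro j hj
      have hj' : j ≤ nScales β := Nat.lt_succ_iff.mp hj
      have h := hle j hj'
      exact ⟨h.2.1, h.1, h.2.2.1, h.2.2.2⟩
    exact h₃main ν hν U hU hU3 β hβmin hβc K hK L M hL3 hM3 (nScales β + 1) le_rfl (hKL _ le_rfl) hhist
  -- child 5: termwise volume limits for this frame
  have hVL : VL β U ν K Mstar := h₅main ν hν U hU hU5 β hβmin hβc K hK Lstar Mstar htower
  -- child 4 at the covariance potential; its conclusion is at ν + U/2 = μ
  have hphys : ν + U / 2 = μ := by rw [hν_def]; ring
  have h4 := h₄main ν hν U hU hU4 β hβmin hβc Lstar Mstar ⟨K, hK, htower, hVL⟩ x y σ σ'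
  rwa [hphys] at h4

/-- **GLUE, v5, on the covariance window `klWindowC`**: the five children give K3 on the analysis window. -/
theorem k3_inductionP5 {Pr : Preds} {VL : VolLimitSlot} (h₃ : EngineP4 Pr klWindowC) (h₁ : BetaSplitP Pr klWindowC)
    (h₂ : CountertermP2 Pr klWindowC) (h₅ : VolumeLimitP3 Pr VL klWindowC) (h₄ : TwoPointAssemblyP3 Pr VL klWindowC) :
    KLRegimeTwoPointLimitMu (-1) (-0.15) :=
  inductionP5 (fun _ hμ _ hU hU' => sub_half_mem_klWindowC hμ hU hU') h₃ h₁ h₂ h₅ h₄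

/-- **The crux modulo S0, from the five v5 children** (as `k3_twoPointLimit_of_childrenP4`). -/
theorem k3_twoPointLimit_of_childrenP5 {Pr : Preds} {VL : VolLimitSlot} (h₃ : EngineP4 Pr klWindowC)
    (h₁ : BetaSplitP Pr klWindowC) (h₂ : CountertermP2 Pr klWindowC) (h₅ : VolumeLimitP3 Pr VL klWindowC)
    (h₄ : TwoPointAssemblyP3 Pr VL klWindowC)
    (hS0 : ∀ δ ∈ Set.Icc (0.10 : ℝ) 0.35,
      chemicalPotentialOfDensity (squareDispersion 1 0) (1 - δ) ∈ Set.Icc (-1 : ℝ) (-0.15)) :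
    ∀ a : ℝ, 0 < a → ∃ U₀ c : ℝ, 0 < U₀ ∧ 0 < c ∧ ∀ δ ∈ Set.Icc (0.10 : ℝ) 0.35, ∀ U β : ℝ, 0 < U → U ≤ U₀ →
      Real.exp (a / U) ≤ β → β ≤ Real.exp (c / U ^ 2) → ∀ (x y : Site 2) (σ σ' : Fin 2), ∃ S : ℂ,
        Tendsto (fun L : ℕ => hubbardThermalTwoPoint β U
          (chemicalPotentialOfDensity (squareDispersion 1 0) (1 - δ)) L x y σ σ') atTop (nhds S) := by
  intro a ha
  obtain ⟨U₀, c, hU₀, hc, H⟩ := k3_inductionP5 h₃ h₁ h₂ h₅ h₄ a ha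
  exact ⟨U₀, c, hU₀, hc, fun δ hδ U β hU hUle hβ hβ' x y σ σ' => H _ (hS0 δ hδ) U β hU hUle hβ hβ' x y σ σ'⟩

/-- The v5 glue also serves the v4 five-tuple (via `volumeLimitP3_of_volumeLimitP2`): nothing proved towards `VolumeLimitP2` is lost. -/
theorem k3_inductionP5_of_P4 {Pr : Preds} {VL : VolLimitSlot} (h₃ : EngineP4 Pr klWindowC) (h₁ : BetaSplitP Pr klWindowC)
    (h₂ : CountertermP2 Pr klWindowC) (h₅ : VolumeLimitP2 Pr VL klWindowC) (h₄ : TwoPointAssemblyP3 Pr VL klWindowC) :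
    KLRegimeTwoPointLimitMu (-1) (-0.15) :=
  k3_inductionP5 h₃ h₁ h₂ (volumeLimitP3_of_volumeLimitP2 h₅) h₄

end Summit.HubbardSuperconductivity.HubbardSuperconductivity.Theorems.KLRegimeSplit

end
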